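import Summits.QuantumFields.YangMills.Theorems.UnitScaleTiltProp7GreenKernelSiteTransport
import Summits.QuantumFields.YangMills.Theorems.UnitScaleTiltProp7CentreHarmonicInterpKernel
import HarnessLib

/-!
# Route `UnitScaleTilt`, crux K1 «MinimiserStabilityRegPr» (stmt-QuantumFields-19200), route-R E′ path (α′), residue (hK), assembly (A), row (I-site):
# THE PINNED BIHARMONIC GREEN MATRIX IS SYMMETRIC, HENCE EVERY DATUM HAS A PINNED-BIHARMONIC INTERPOLANT — from the exported rows of
# ✓ `Prop7GreenKernelSiteTransport.exists_green_site_split` alone (representation `hGrep`, vanishing `hG0`, source `Δ²G(x,·) = δ_x − δ_{y_c}` off `C`):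
# `G(x,z) = G(z,x)`, and `F_H := F − Σ_z G(·,z)·(Δ²F)(z)` interpolates `F` on `C` with `Δ²F_H = 0` off `C`

Cell `ym3-torus`, width seat `ym3-torus-px22` (gen 2) = the (A)-instantiation seat (★routeR-w3 g5 19:59:56Z); LOCATE 19200 evidence `LOCATE-A3-FARFIELD-px22g2.md`
v1.2 §5 row (I-site).  `--supports stmt-QuantumFields-19200`, count-neutral.  THEOREMS ONLY (0 `def`, 0 `sorry`).  YM₃ on T³ is a ladder rung (R3), not the Clay
problem; nothing here claims the stub, the crux, d = 4 or the gap.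

THE POINT.  The (A-door) ✓ `Prop7PinnedKernelL1OfRows.sum_abs_laplace_sub_interp_le_of_rows` wants, besides the interpolant `U` of `V` that (R5) exports, a pinned-biharmonic
interpolant `U₂` of the near datum `u|_C`.  No transport of ✓p657675 is needed: Maxwell–Betti reciprocity `G(x,z) = G(z,x)` follows in three lines from (R5)'s rows
(test `hGrep` with the pinned function `G(x,·)` itself), and then `x ↦ Σ_z G(x,z)(Δ²F)(z)` is pinned (symmetry + `hG0`) with bi-Laplacian `Δ²F` off `C`
(symmetry + the source row), so `F` minus it is the interpolant.

WHAT IS PROVED (ns `…Theorems.Prop7PinnedGreenSymmetry`; torus `T^{(j)}`, lattice factor `c`, centre set `C ∋ y_c`, real site fields; abstract `G` with three displayed rows).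
* §1 `laplace_sum_mul` (`Δ` acts termwise on `x ↦ Σ_z G(x,z)·a(z)`), ★★ `green_symm` (`G(x,z) = G(z,x)`).
* §2 ★★★ `exists_pinned_interp_of_green` — `∀ F, ∃ F_H, F_H|_C = F|_C ∧ Δ²F_H = 0 off C`; `interp_eq` records the formula `F_H = F − Σ_z G(·,z)(Δ²F)(z)`.
* §3 ★★★ `exists_green_site_split_symm` — ✓p662031's seven rows on `Site P 0` (real case) RE-EXPORTED with two more: symmetry and the interpolant of every datum.
HONEST SCOPE.  Linear algebra on displayed rows; the only instance is §3 (`j = 0`, `C = range (embIter k)`, `y_c = embIter k default`, any `c ≠ 0`).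

References: T. Bałaban, CMP 95 (1984) 17–40 [Balaban1984PropagatorsI] (Sect. C p.22, (1.21) p.21); CMP 99 (1985) 75–102 [Balaban1985RegularSpaces] ((1.14) p.78).
-/

set_option autoImplicit false

noncomputable section

open scoped BigOperators

namespace Summit.QuantumFields.YangMills.Theorems.Prop7PinnedGreenSymmetry

open Literature.MathematicalPhysics.QuantumFieldTheory.Balaban1983to89
open Finset LatticeFieldCalculus

variable {P : Params} {j : ℕ}

/-! ## §1 Symmetry -/

/-- `Δ` acts termwise on a kernel integrated against a fixed vector: `Δ(x ↦ Σ_z G(x,z)a(z))(w) = Σ_z (Δ G(·,z))(w)·a(z)`. [cite: Balaban1984PropagatorsI, (1.21) p.21] -/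
theorem laplace_sum_mul (c : ℝ) (G : Site P j → Site P j → ℝ) (a : SiteField P j ℝ) (w : Site P j) :
    laplace c (fun x => ∑ z, G x z * a z) w = ∑ z, laplace c (fun x => G x z) w * a z := by
  simp only [laplace, smul_eq_mul, Finset.mul_sum, ← Finset.sum_sub_distrib, ← Finset.sum_add_distrib]
  rw [Finset.sum_comm]
  refine Finset.sum_congr rfl fun z _ => ?_
  rw [Finset.sum_mul]
  refine Finset.sum_congr rfl fun μ _ => ?_
  ring

/-- ★★ **RECIPROCITY: THE PINNED BIHARMONIC GREEN MATRIX IS SYMMETRIC.**  If `G(x,·)` vanishes on `C` (hG0), represents every pinned function through its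
bi-Laplacian (hGrep), and has bi-Laplacian `δ_x − δ_{y_c}` off `C` (hsrc, `y_c ∈ C`), then `G(x,z) = G(z,x)`: test hGrep at `z` with the pinned function `G(x,·)`.
[cite: Balaban1984PropagatorsI, Sect. C p.22] -/
theorem green_symm (c : ℝ) (C : Set (Site P j)) (G : Site P j → Site P j → ℝ) (y_c : Site P j) (hyc : y_c ∈ C)
    (hG0 : ∀ x, ∀ y ∈ C, G x y = 0)
    (hGrep : ∀ e : SiteField P j ℝ, (∀ y ∈ C, e y = 0) → ∀ x, e x = ∑ z, G x z * laplace c (laplace c e) z)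
    (hsrc : ∀ x w, w ∉ C → laplace c (laplace c (G x)) w = (if w = x then (1 : ℝ) else 0) - (if w = y_c then (1 : ℝ) else 0))
    (x z : Site P j) : G x z = G z x := by
  classical
  have h := hGrep (G x) (hG0 x) z
  rw [h]
  have hterm : ∀ w, G z w * laplace c (laplace c (G x)) w = G z w * (if w = x then (1 : ℝ) else 0) := by
    intro w
    by_cases hw : w ∈ C
    · rw [hG0 z w hw, zero_mul, zero_mul]
    · rw [hsrc x w hw]
      have hwy : w ≠ y_c := fun h => hw (h ▸ hyc)
      simp [hwy]
  rw [Finset.sum_congr rfl fun w _ => hterm w]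
  simp [Finset.sum_ite_eq']

/-! ## §2 The interpolant of an arbitrary datum -/

/-- ★★★ **EVERY DATUM HAS A PINNED-BIHARMONIC INTERPOLANT** (row (I-site) of the (A) assembly): under the three rows of `green_symm`, for every `F` the function
`F_H := F − Σ_z G(·,z)·(Δ²F)(z)` satisfies `F_H|_C = F|_C` and `Δ²F_H = 0` off `C`. [cite: Balaban1984PropagatorsI, Sect. C p.22; Balaban1985RegularSpaces, (1.14) p.78] -/
theorem interp_eq (c : ℝ) (C : Set (Site P j)) (G : Site P j → Site P j → ℝ) (y_c : Site P j) (hyc : y_c ∈ C)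
    (hG0 : ∀ x, ∀ y ∈ C, G x y = 0)
    (hGrep : ∀ e : SiteField P j ℝ, (∀ y ∈ C, e y = 0) → ∀ x, e x = ∑ z, G x z * laplace c (laplace c e) z)
    (hsrc : ∀ x w, w ∉ C → laplace c (laplace c (G x)) w = (if w = x then (1 : ℝ) else 0) - (if w = y_c then (1 : ℝ) else 0))
    (F : SiteField P j ℝ) :
    (∀ y ∈ C, (fun x => F x - ∑ z, G x z * laplace c (laplace c F) z) y = F y)
      ∧ ∀ w ∉ C, laplace c (laplace c (fun x => F x - ∑ z, G x z * laplace c (laplace c F) z)) w = 0 := by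
  classical
  have hsymm := green_symm c C G y_c hyc hG0 hGrep hsrc
  refine ⟨fun y hy => ?_, fun w hw => ?_⟩
  · -- pinned: `Σ_z G(y,z)(Δ²F)(z) = Σ_z G(z,y)(…) = 0`
    have h0 : ∑ z, G y z * laplace c (laplace c F) z = 0 :=
      Finset.sum_eq_zero fun z _ => by rw [hsymm y z, hG0 z y hy, zero_mul]
    simp only [h0, sub_zero]
  · -- `Δ²` of the correction reproduces `Δ²F` off `C`
    have e1 : (fun x => F x - ∑ z, G x z * laplace c (laplace c F) z) = fun x => F x - (fun x' => ∑ z, G x' z * laplace c (laplace c F) z) x := rfl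
    rw [e1, Prop7CentreHarmonicInterpKernel.laplace_sub', Prop7CentreHarmonicInterpKernel.laplace_sub']
    dsimp only
    rw [show (laplace c fun x' => ∑ z, G x' z * laplace c (laplace c F) z) = fun w' => ∑ z, laplace c (fun x => G x z) w' * laplace c (laplace c F) z
      from funext fun w' => laplace_sum_mul c G _ w']
    rw [laplace_sum_mul c (fun w' z => laplace c (fun x => G x z) w') _ w]
    have hcol : ∀ z, laplace c (fun w' => laplace c (fun x => G x z) w') w = laplace c (laplace c (G z)) w := by
      intro z
      have ez : (fun x => G x z) = G z := funext fun x => hsymm x z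
      rw [ez]
    have hterm : ∀ z, laplace c (fun w' => laplace c (fun x => G x z) w') w * laplace c (laplace c F) z
        = (if w = z then (1 : ℝ) else 0) * laplace c (laplace c F) z := by
      intro z
      rw [hcol z, hsrc z w hw]
      have hwy : w ≠ y_c := fun h => hw (h ▸ hyc)
      simp [hwy]
    rw [Finset.sum_congr rfl fun z _ => hterm z]
    simp [Finset.sum_ite_eq]

/-- ★★★ packaged: `∃ F_H, F_H|_C = F|_C ∧ Δ²F_H = 0 off C`. [cite: Balaban1985RegularSpaces, (1.14) p.78] -/
theorem exists_pinned_interp_of_green (c : ℝ) (C : Set (Site P j)) (G : Site P j → Site P j → ℝ) (y_c : Site P j) (hyc : y_c ∈ C)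
    (hG0 : ∀ x, ∀ y ∈ C, G x y = 0)
    (hGrep : ∀ e : SiteField P j ℝ, (∀ y ∈ C, e y = 0) → ∀ x, e x = ∑ z, G x z * laplace c (laplace c e) z)
    (hsrc : ∀ x w, w ∉ C → laplace c (laplace c (G x)) w = (if w = x then (1 : ℝ) else 0) - (if w = y_c then (1 : ℝ) else 0))
    (F : SiteField P j ℝ) :
    ∃ FH : SiteField P j ℝ, (∀ y ∈ C, FH y = F y) ∧ ∀ w ∉ C, laplace c (laplace c FH) w = 0 :=
  ⟨_, interp_eq c C G y_c hyc hG0 hGrep hsrc F⟩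

/-! ## §3 The instance of record: `Site P 0`, pins `range (embIter k)`, the Green matrix of ✓ `exists_green_site_split` -/

/-- ★★★ **ON THE FINEST TORUS OF RECORD**: the pinned-biharmonic Green matrix `G` of ✓ `Prop7GreenKernelSiteTransport.exists_green_site_split` (any `c ≠ 0`, pins
`range (embIter k)`) is symmetric, and every real datum `F` on `Site P 0` has a pinned interpolant biharmonic off the pins — exported TOGETHER with `G`'s split rows so a
consumer obtains everything in one `obtain`. [cite: Balaban1984PropagatorsI, Sect. C p.22; Balaban1985RegularSpaces, (1.14) p.78] -/
theorem exists_green_site_split_symm {k : ℕ} (hk : k ≤ P.m + P.K) {c : ℝ} (hc : c ≠ 0) :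
    ∃ Gf Uf G : Site P 0 → Site P 0 → ℝ,
      (∀ x z, G x z = Gf x z - Uf x z)
      ∧ (∀ x (y : Site P k), Uf x (B15DeterminingSets.embIter k y) = Gf x (B15DeterminingSets.embIter k y))
      ∧ (∀ x, ∀ y ∈ Set.range (B15DeterminingSets.embIter (P := P) k), G x y = 0)
      ∧ (∀ x z, z ∉ Set.range (B15DeterminingSets.embIter (P := P) k) → laplace c (laplace c (Uf x)) z = 0)
      ∧ (∀ x z, laplace c (Gf x) z = (2 * c ^ 2)⁻¹ *
          (Literature.Probability.LatticeModels.torusGreen (L := P.L ^ k * P.sitesPerDir k) (B5Eq117TorusCarriers.EK hk z - B5Eq117TorusCarriers.EK hk x)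
            - Literature.Probability.LatticeModels.torusGreen (L := P.L ^ k * P.sitesPerDir k)
                (B5Eq117TorusCarriers.EK hk z - B5Eq117TorusCarriers.EK hk (B15DeterminingSets.embIter k default))))
      ∧ (∀ x z, laplace c (laplace c (Gf x)) z = (if z = x then (1 : ℝ) else 0) - (if z = B15DeterminingSets.embIter k default then (1 : ℝ) else 0))
      ∧ (∀ e : SiteField P 0 ℝ, (∀ y ∈ Set.range (B15DeterminingSets.embIter (P := P) k), e y = 0) →
          ∀ x, e x = ∑ z, G x z * laplace c (laplace c e) z)
      ∧ (∀ x z, G x z = G z x)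
      ∧ ∀ F : SiteField P 0 ℝ, ∃ FH : SiteField P 0 ℝ,
          (∀ y ∈ Set.range (B15DeterminingSets.embIter (P := P) k), FH y = F y)
          ∧ ∀ w ∉ Set.range (B15DeterminingSets.embIter (P := P) k), laplace c (laplace c FH) w = 0 := by
  classical
  obtain ⟨Gf, Uf, G, hsplit, hUC, hG0, hUel, hGf1, hGf2, hGrep⟩ :=
    Prop7GreenKernelSiteTransport.exists_green_site_split (P := P) hk hc (V := ℝ)
  set C : Set (Site P 0) := Set.range (B15DeterminingSets.embIter (P := P) k) with hC
  have hyc : B15DeterminingSets.embIter (P := P) k default ∈ C := ⟨default, rfl⟩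
  have hGrep' : ∀ e : SiteField P 0 ℝ, (∀ y ∈ C, e y = 0) → ∀ x, e x = ∑ z, G x z * laplace c (laplace c e) z := by
    intro e he x
    have h := hGrep e he x
    simpa only [smul_eq_mul] using h
  have hsrc : ∀ x w, w ∉ C → laplace c (laplace c (G x)) w
      = (if w = x then (1 : ℝ) else 0) - (if w = B15DeterminingSets.embIter (P := P) k default then (1 : ℝ) else 0) := by
    intro x w hw
    have eG : G x = fun z => Gf x z - Uf x z := funext fun z => hsplit x z
    rw [eG, Prop7CentreHarmonicInterpKernel.laplace_sub', Prop7CentreHarmonicInterpKernel.laplace_sub']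
    dsimp only
    rw [hUel x w hw, sub_zero, hGf2 x w]
  exact ⟨Gf, Uf, G, hsplit, hUC, hG0, hUel, hGf1, hGf2, hGrep', green_symm c C G _ hyc hG0 hGrep' hsrc,
    fun F => exists_pinned_interp_of_green c C G _ hyc hG0 hGrep' hsrc F⟩

end Summit.QuantumFields.YangMills.Theorems.Prop7PinnedGreenSymmetry

end
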